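import Literature.NumberTheory.NumberFields.CubicFieldDedekindKummer
import Literature.NumberTheory.NumberFields.IntegralBasisIndex
import Mathlib.Tactic.NormNum.Prime
import HarnessLib

/-!
# The complex cubic field of discriminant `-14483 = -7 · 2069`: `𝓞 K = ℤ[γ, δ]`, `γ³ - γ² + 27γ + 36 = 0`,
# `δ = (γ² - γ + 18)/3`; exponents, residue maps, the unit `ε = -15 - γ + 2δ`

Topic `NumberTheory/NumberFields`, sub-namespace `CubicField14483`. This is the `2`-division field
`L = ℚ(x(T₂))` of the elliptic curve `E_{28/9} : y² - 19xy - 2268y = x³ - 252x²` (`kubertTateFive 28 9`,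
rank `2`, `Ш(E)[5^∞] = 0` proved in the tree), the base field of the generic `2`-descent of
`Literature/NumberTheory/EllipticCurves/TwoDescentOneRootParity.lean` for that curve; the present file is the
field-arithmetic layer, written — exactly like the tree's `RankNotSumOfLocalInvariantsF3CubicK1339a.lean`
(index `14`) — for an ABSTRACT number field `K` with `[K : ℚ] = 3` and a root `γ ∈ K` of
`f = X³ - X² + 27X + 36` (Marcus, *Number Fields*, Ch. 2–3: discriminant, index, Dedekind–Kummer).
Everything is PROVED; no definition is introduced (the algebraic integers `γ`, `δ` are
`MonicCubic.thetaInt _`).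

* §1 `f` is irreducible (no root modulo `11`), `Δ(f) = -130347 = -3² · 14483`, `14483 = 7 · 2069` squarefree;
  `δ = (γ² - γ + 18)/3` is a root of `g = X³ - 31X - 114`, irreducible, `Δ(g) = -231728 = -4² · 14483`.
* §2 **`3 · 𝓞 K ⊆ ℤ[γ]`** and **`4 · 𝓞 K ⊆ ℤ[δ]`** (`mem3`, `mem4_delta`: `disc = indexDet² · d_K` with
  squarefree cofactor, `IntegralBasisIndex.mul_mem_adjoin_of_discr_eq_sq_mul`); hence `p ∤ exponent(γ)` for every
  prime `p ≠ 3` and `p ∤ exponent(δ)` for every prime `p ≠ 2` (Dedekind–Kummer is available at EVERY prime: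
  at `2, 7, 2069` through `γ`, at `3` through `δ`).
* §3 the relations `3δ = γ² - γ + 18`, `γ² = -18 + γ + 3δ`, `γδ = -12 - 3γ`, `δ² = 22 - 4γ + 3δ` in `𝓞 K`
  (`ℤ[γ, δ] = ℤ ⊕ ℤγ ⊕ ℤδ` is a ring), the coercion of `a + bγ + cδ`, and ring homomorphisms `𝓞 K → S` out
  of roots of `f` in rings `S` with `3` invertible (residue maps at `p ≠ 3`; `exists_ringHom`) and out of roots
  of `g` with `2` invertible (`exists_ringHom_delta`, residue maps at `3`).
* §4 the unit **`ε = -15 - γ + 2δ`**, `ε⁻¹ = 183 - 19γ + 47δ` (`isUnit_eps`).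

Numerical provenance (seat bsd-line-spt-p1 g26, pure integer arithmetic): `d_K = -14483`, `Cl(K) ≅ ℤ/8`
generated by the prime `(2, γ)`, `K(S, 2)` for `S ∣ 2·3·7·2069` of dimension `11`; these are NOT proved here.

## References
* [Marcus2018] D. A. Marcus, *Number Fields*, 2nd ed. (2018), Ch. 2 (Thm. 4, Ex. 27), Ch. 3 (Thm. 27).
* [Cassels1991LecturesEllipticCurves] J. W. S. Cassels, *Lectures on Elliptic Curves*, §15 (the cubic field
  `ℚ[Θ]` of the `2`-descent).
-/

noncomputable section

open Polynomial Module NumberField Ideal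
open scoped NumberField

namespace Literature.NumberTheory.NumberFields

namespace CubicField14483

open MonicCubic

variable {K : Type*} [Field K] [NumberField K] {γ : K}

/-! ### §1 The data: `f = X³ - X² + 27X + 36`, `g = X³ - 31X - 114`, `Δ = -3²·14483`, `-4²·14483` -/

omit [NumberField K] in
/-- A root of `f` in the `MonicCubic.poly` normal form. [cite: Marcus2018, Ch. 2, Exercise 27] -/
theorem aeval_eq (hγ : γ ^ 3 - γ ^ 2 + 27 * γ + 36 = 0) :
    aeval γ (MonicCubic.poly (-1) 27 36) = 0 := by
  simp only [MonicCubic.poly, map_add, map_mul, map_pow, aeval_X, eq_intCast, map_intCast]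
  push_cast
  linear_combination hγ

/-- `f` has no root modulo `11` (`11` is inert). [cite: Marcus2018, Ch. 3, Thm. 27] -/
theorem no_root_eleven :
    ∀ r : ZMod 11, r ^ 3 + ((-1 : ℤ) : ZMod 11) * r ^ 2 + ((27 : ℤ) : ZMod 11) * r +
      ((36 : ℤ) : ZMod 11) ≠ 0 := by
  decide

/-- `f` is irreducible over `ℚ`. [cite: Marcus2018, Ch. 3, Thm. 27] -/
theorem irreducible_polyQ : Irreducible (MonicCubic.polyQ (-1) 27 36) :=
  haveI : Fact (Nat.Prime 11) := ⟨by norm_num⟩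
  irreducible_polyQ_of_no_root 11 no_root_eleven

/-- `Δ(f) = -130347 = -3² · 14483`. [cite: Marcus2018, Ch. 2, Exercise 27] -/
theorem disc_eq : MonicCubic.disc (-1) 27 36 = 3 ^ 2 * (-14483) := by norm_num [MonicCubic.disc]

/-- `14483 = 7 · 2069` is squarefree (both factors prime). [cite: Marcus2018, Ch. 2, Exercise 27(e)] -/
theorem squarefree_neg_14483 : Squarefree (-14483 : ℤ) := by
  rw [← Int.squarefree_natAbs, show (-14483 : ℤ).natAbs = 7 * 2069 by norm_num]
  have h7 : Nat.Prime 7 := by norm_num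
  have h2069 : Nat.Prime 2069 := by norm_num
  exact (Nat.squarefree_mul (by norm_num : Nat.Coprime 7 2069)).mpr ⟨h7.squarefree, h2069.squarefree⟩

/-- `δ = (γ² - γ + 18)/3` is a root of `g = X³ - 31X - 114`. [cite: Marcus2018, Ch. 2, Exercise 27] -/
theorem delta_root (hγ : γ ^ 3 - γ ^ 2 + 27 * γ + 36 = 0) :
    aeval ((γ ^ 2 - γ + 18) / 3) (MonicCubic.poly 0 (-31) (-114)) = 0 := by
  simp only [MonicCubic.poly, map_add, map_mul, map_pow, aeval_X, eq_intCast, map_intCast]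
  push_cast
  linear_combination ((1 : K) / 27 * (γ ^ 3 - 2 * γ ^ 2 + 28 * γ - 63)) * hγ

/-- `g` has no root modulo `11`. [cite: Marcus2018, Ch. 3, Thm. 27] -/
theorem no_root_eleven_delta :
    ∀ r : ZMod 11, r ^ 3 + ((0 : ℤ) : ZMod 11) * r ^ 2 + ((-31 : ℤ) : ZMod 11) * r +
      ((-114 : ℤ) : ZMod 11) ≠ 0 := by
  decide

/-- `g` is irreducible over `ℚ`. [cite: Marcus2018, Ch. 3, Thm. 27] -/
theorem irreducible_polyQ_delta : Irreducible (MonicCubic.polyQ 0 (-31) (-114)) :=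
  haveI : Fact (Nat.Prime 11) := ⟨by norm_num⟩
  irreducible_polyQ_of_no_root 11 no_root_eleven_delta

/-- `Δ(g) = -231728 = -4² · 14483`. [cite: Marcus2018, Ch. 2, Exercise 27] -/
theorem disc_delta_eq : MonicCubic.disc 0 (-31) (-114) = 4 ^ 2 * (-14483) := by
  norm_num [MonicCubic.disc]

/-! ### §2 `3 · 𝓞 K ⊆ ℤ[γ]`, `4 · 𝓞 K ⊆ ℤ[δ]`, and the Dedekind–Kummer exponents -/

/-- **`3 x ∈ ℤ[γ]` for every algebraic integer `x`** (`Δ(f) = indexDet² · d_K = 3² · (-14483)` with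
`14483` squarefree, so `indexDet ∣ 3` and `indexDet · 𝓞 K ⊆ ℤ[γ]`; the index is in fact `3`).
[cite: Marcus2018, Ch. 2, Exercise 27(c)] -/
theorem mem3 (hγ : γ ^ 3 - γ ^ 2 + 27 * γ + 36 = 0) (h3 : finrank ℚ K = 3) (x : 𝓞 K) :
    ((3 : ℕ) : K) * x ∈ Algebra.adjoin ℤ ({γ} : Set K) := by
  have h := mul_mem_adjoin_of_discr_eq_sq_mul (pb irreducible_polyQ (aeval_eq hγ) h3)
    (isIntegral_pb_gen irreducible_polyQ (aeval_eq hγ) h3) 3 (-14483)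
    (by rw [discr_pb, disc_eq]) squarefree_neg_14483 x
  rw [pb_gen] at h
  exact_mod_cast h

/-- **`4 x ∈ ℤ[δ]` for every algebraic integer `x`** (`Δ(g) = 4² · (-14483)`). [cite: Marcus2018, Ch. 2, Exercise 27(c)] -/
theorem mem4_delta (hγ : γ ^ 3 - γ ^ 2 + 27 * γ + 36 = 0) (h3 : finrank ℚ K = 3) (x : 𝓞 K) :
    ((4 : ℕ) : K) * x ∈ Algebra.adjoin ℤ ({(γ ^ 2 - γ + 18) / 3} : Set K) := by
  have h := mul_mem_adjoin_of_discr_eq_sq_mul (pb irreducible_polyQ_delta (delta_root hγ) h3)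
    (isIntegral_pb_gen irreducible_polyQ_delta (delta_root hγ) h3) 4 (-14483)
    (by rw [discr_pb, disc_delta_eq]) squarefree_neg_14483 x
  rw [pb_gen] at h
  exact_mod_cast h

/-- `p ∤ exponent(γ)` for every prime `p ≠ 3` (so Dedekind–Kummer applies to `f` at `2`, `7`, `2069`, …).
[cite: Marcus2018, Ch. 3, Thm. 27] -/
theorem not_dvd_exponent (hγ : γ ^ 3 - γ ^ 2 + 27 * γ + 36 = 0) (h3 : finrank ℚ K = 3)
    {p : ℕ} (hp : p.Prime) (hp3 : p ≠ 3) :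
    ¬ p ∣ RingOfIntegers.exponent (thetaInt (aeval_eq hγ)) :=
  MonicCubic.not_dvd_exponent (aeval_eq hγ) (mem3 hγ h3) fun h =>
    hp3 ((Nat.prime_dvd_prime_iff_eq hp Nat.prime_three).mp h)

/-- `p ∤ exponent(δ)` for every prime `p ≠ 2` (so Dedekind–Kummer applies to `g` at `3`).
[cite: Marcus2018, Ch. 3, Thm. 27] -/
theorem not_dvd_exponent_delta (hγ : γ ^ 3 - γ ^ 2 + 27 * γ + 36 = 0) (h3 : finrank ℚ K = 3)
    {p : ℕ} (hp : p.Prime) (hp2 : p ≠ 2) :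
    ¬ p ∣ RingOfIntegers.exponent (thetaInt (delta_root hγ)) :=
  MonicCubic.not_dvd_exponent (delta_root hγ) (mem4_delta hγ h3) fun h => by
    have h' : p ∣ 2 ^ 2 := by simpa using h
    exact hp2 ((Nat.prime_dvd_prime_iff_eq hp Nat.prime_two).mp (hp.dvd_of_dvd_pow h'))

/-! ### §3 The ring `ℤ[γ, δ]`: relations, coercions, ring homomorphisms -/

/-- The underlying elements: `γ` and `δ = (γ² - γ + 18)/3`. [cite: Marcus2018, Ch. 2, Exercise 27] -/
theorem coe_gamma_delta (hγ : γ ^ 3 - γ ^ 2 + 27 * γ + 36 = 0) :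
    ((thetaInt (aeval_eq hγ) : 𝓞 K) : K) = γ ∧
      ((thetaInt (delta_root hγ) : 𝓞 K) : K) = (γ ^ 2 - γ + 18) / 3 := ⟨rfl, rfl⟩

/-- **`3δ = γ² - γ + 18`** in `𝓞 K`. [cite: Marcus2018, Ch. 2, Exercise 27] -/
theorem three_delta (hγ : γ ^ 3 - γ ^ 2 + 27 * γ + 36 = 0) :
    3 * thetaInt (delta_root hγ) = thetaInt (aeval_eq hγ) ^ 2 - thetaInt (aeval_eq hγ) + 18 := by
  rw [RingOfIntegers.ext_iff]
  simp only [map_mul, map_add, map_sub, map_pow, map_ofNat, MonicCubic.thetaInt, RingOfIntegers.map_mk]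
  ring

/-- The cubic relation for `γ` in `𝓞 K`. [cite: Marcus2018, Ch. 2, Exercise 27] -/
theorem gamma_rel (hγ : γ ^ 3 - γ ^ 2 + 27 * γ + 36 = 0) :
    thetaInt (aeval_eq hγ) ^ 3 - thetaInt (aeval_eq hγ) ^ 2 + 27 * thetaInt (aeval_eq hγ) + 36 = 0 := by
  have := MonicCubic.thetaInt_rel (aeval_eq hγ)
  push_cast at this
  linear_combination this

/-- **The multiplication table of `ℤ[γ, δ] = ℤ ⊕ ℤγ ⊕ ℤδ`**: `γ² = -18 + γ + 3δ`, `γδ = -12 - 3γ`,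
`δ² = 22 - 4γ + 3δ`. [cite: Marcus2018, Ch. 2, Exercise 27] -/
theorem mul_table (hγ : γ ^ 3 - γ ^ 2 + 27 * γ + 36 = 0) :
    thetaInt (aeval_eq hγ) ^ 2 = -18 + thetaInt (aeval_eq hγ) + 3 * thetaInt (delta_root hγ) ∧
    thetaInt (aeval_eq hγ) * thetaInt (delta_root hγ) = -12 - 3 * thetaInt (aeval_eq hγ) ∧
    thetaInt (delta_root hγ) ^ 2 =
      22 - 4 * thetaInt (aeval_eq hγ) + 3 * thetaInt (delta_root hγ) := by
  refine ⟨?_, ?_, ?_⟩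
  · rw [RingOfIntegers.ext_iff]
    simp only [map_mul, map_add, map_neg, map_pow, map_ofNat, MonicCubic.thetaInt, RingOfIntegers.map_mk]
    ring
  · rw [RingOfIntegers.ext_iff]
    simp only [map_mul, map_sub, map_neg, map_ofNat, MonicCubic.thetaInt, RingOfIntegers.map_mk]
    linear_combination ((1 : K) / 3) * hγ
  · rw [RingOfIntegers.ext_iff]
    simp only [map_mul, map_add, map_sub, map_pow, map_ofNat, MonicCubic.thetaInt, RingOfIntegers.map_mk]
    linear_combination ((1 : K) / 9 * (γ - 1)) * hγ

/-- The coercion of `a + bγ + cδ` to `K`, on the power basis `1, γ, γ²`. [cite: Marcus2018, Ch. 2, Exercise 27] -/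
theorem coe_lin (hγ : γ ^ 3 - γ ^ 2 + 27 * γ + 36 = 0) (a b c : ℤ) :
    (((a : 𝓞 K) + b * thetaInt (aeval_eq hγ) + c * thetaInt (delta_root hγ) : 𝓞 K) : K) =
      ((a + 6 * c : ℚ) : K) + ((b - c / 3 : ℚ) : K) * γ + ((c / 3 : ℚ) : K) * γ ^ 2 := by
  simp only [map_add, map_mul, map_intCast, MonicCubic.thetaInt, RingOfIntegers.map_mk]
  push_cast
  ring

/-- **Ring homomorphisms `𝓞 K → S` from roots of `f` in rings `S` with `3` invertible** (e.g. `S = ℤ/p`,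
`p ≠ 3`, or `(ℤ/2ᵏ)[t]/(f)`), with the value on `δ`: `3 ψ(δ) = τ² - τ + 18`. [cite: Marcus2018, Ch. 3, Thm. 27] -/
theorem exists_ringHom (hγ : γ ^ 3 - γ ^ 2 + 27 * γ + 36 = 0) (h3 : finrank ℚ K = 3)
    {S : Type*} [CommRing S] (τ : S)
    (hτ : τ ^ 3 + ((-1 : ℤ) : S) * τ ^ 2 + ((27 : ℤ) : S) * τ + ((36 : ℤ) : S) = 0) (s' : S)
    (hs' : ((3 : ℕ) : S) * s' = 1) :
    ∃ ψ : 𝓞 K →+* S, ψ (thetaInt (aeval_eq hγ)) = τ ∧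
      3 * ψ (thetaInt (delta_root hγ)) = τ ^ 2 - τ + 18 := by
  obtain ⟨ψ, hψ⟩ := exists_ringHom_of_root_of_mul_mem irreducible_polyQ (aeval_eq hγ) h3
    (mem3 hγ h3) τ hτ s' hs'
  refine ⟨ψ, hψ, ?_⟩
  have h := congrArg ψ (three_delta hγ)
  rw [map_mul, map_ofNat, map_add, map_sub, map_pow, map_ofNat, hψ] at h
  exact h

/-- **Ring homomorphisms `𝓞 K → S` from roots of `g` in rings `S` with `2` invertible** (e.g. `S = ℤ/3`),
with the value on `γ`: `ψ(γ) · (σ + 3) = -12` (from `γδ = -12 - 3γ`). [cite: Marcus2018, Ch. 3, Thm. 27] -/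
theorem exists_ringHom_delta (hγ : γ ^ 3 - γ ^ 2 + 27 * γ + 36 = 0) (h3 : finrank ℚ K = 3)
    {S : Type*} [CommRing S] (σ : S)
    (hσ : σ ^ 3 + ((0 : ℤ) : S) * σ ^ 2 + ((-31 : ℤ) : S) * σ + ((-114 : ℤ) : S) = 0) (s' : S)
    (hs' : ((4 : ℕ) : S) * s' = 1) :
    ∃ ψ : 𝓞 K →+* S, ψ (thetaInt (delta_root hγ)) = σ ∧
      ψ (thetaInt (aeval_eq hγ)) * (σ + 3) = -12 := by
  obtain ⟨ψ, hψ⟩ := exists_ringHom_of_root_of_mul_mem irreducible_polyQ_delta (delta_root hγ) h3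
    (mem4_delta hγ h3) σ hσ s' hs'
  refine ⟨ψ, hψ, ?_⟩
  have h := congrArg ψ (mul_table hγ).2.1
  rw [map_mul, map_sub, map_neg, map_mul, map_ofNat, map_ofNat, hψ] at h
  linear_combination h

/-! ### §4 The unit `ε = -15 - γ + 2δ` -/

/-- **`ε · (183 - 19γ + 47δ) = 1`**: `ε = -15 - γ + 2δ` is a unit of `𝓞 K` (of norm `+1`; numerically a
fundamental unit, `|σ_ℝ(ε)| ≈ 0.00189`). [cite: Marcus2018, Ch. 5, Thm. 38] -/
theorem eps_mul_inv (hγ : γ ^ 3 - γ ^ 2 + 27 * γ + 36 = 0) :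
    (-15 - thetaInt (aeval_eq hγ) + 2 * thetaInt (delta_root hγ)) *
      (183 - 19 * thetaInt (aeval_eq hγ) + 47 * thetaInt (delta_root hγ)) = 1 := by
  rw [RingOfIntegers.ext_iff]
  simp only [map_mul, map_add, map_sub, map_neg, map_ofNat, map_one, MonicCubic.thetaInt,
    RingOfIntegers.map_mk]
  linear_combination ((1 : K) / 9 * (94 * γ - 349)) * hγ

/-- `ε = -15 - γ + 2δ` is a unit of `𝓞 K`. [cite: Marcus2018, Ch. 5, Thm. 38] -/
theorem isUnit_eps (hγ : γ ^ 3 - γ ^ 2 + 27 * γ + 36 = 0) :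
    IsUnit (-15 - thetaInt (aeval_eq hγ) + 2 * thetaInt (delta_root hγ)) :=
  IsUnit.of_mul_eq_one _ (eps_mul_inv hγ)

end CubicField14483

end Literature.NumberTheory.NumberFields

end
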